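import Mathlib.MeasureTheory.Integral.Prod
import Literature.Analysis.FunctionSpaces.TorusFourierModes
import Literature.Analysis.FunctionSpaces.TorusSpaceTime
import Literature.Analysis.FunctionSpaces.TorusRieszFischerParam
import Literature.Analysis.FunctionSpaces.FlatTorusProofs
import HarnessLib

/-!
# Time-dependent fields on `T^d`: continuity of slice functionals, measurability of lifts,
# and `L²` fields with prescribed Fourier coefficients for every time

Trunk: Sobolev (`Literature/Analysis/FunctionSpaces`). Theorem-only tools for the passage to
the limit in the Fourier–Galerkin method on the torus (Robinson–Rodrigo–Sadowski 2016, Thm. 4.4,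
Steps 3–4 and Thm. 4.11; Hopf 1951, §4), where the limit velocity is first obtained as a family of
Fourier coefficients `c(t, k)` — continuous in `t`, square summable in `k` locally uniformly in
`t` — and has to be realised as an honest space–time measurable field `u : ℝ → T^d → ℝ^d` with
`û(t) = c(t)` for **every** `t ≥ 0` (every slice matters for the energy inequality and the weak
continuity of Leray–Hopf solutions).

## Contents (all proved)

* Slices of fields with continuous space–time lift: `Torus.continuous_slice_of_continuousOn_stLift`,
  continuity in time of space integrals `t ↦ ∫ u t` (`continuousOn_integral_of_continuousOn_stLift`,
  tube lemma over the compact torus), of pairings `t ↦ ∫ ⟪u t, v t⟫`, of `t ↦ ∫ ‖u t‖²`, and of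
  the spatial Fourier coefficients `t ↦ 𝓕(u t)(k)`.
* Slices of `L²ₜL²ₓ` fields given through a measurable space–time lift on `(0, ∞) × ℝ^d`:
  `Torus.aestronglyMeasurable_uncurry_prod_of_stLift`, a.e. slice is in `L²(T^d)`
  (`Torus.ae_memLp_slice`), time-measurability of the spatial Fourier coefficients
  (`Torus.aestronglyMeasurable_mFourierCoeff_stSlice`, Fubini).
* `Torus.quasiMeasurePreserving_proj` — the covering map `proj : ℝ^d → T^d` pulls null sets back
  to null sets (`proj⁻¹ N` is a countable union of lattice translates of `proj⁻¹ N ∩ [0,1)^d`,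
  which has the measure of `N`, `Torus.measurePreserving_proj_unitCube`); hence
  `Torus.aestronglyMeasurable_stLift_of_uncurry`: measurability of `uncurry u` on `S × T^d`
  gives measurability of the space–time lift `stLift u` on `S × ℝ^d` (converse of the accepted
  `aestronglyMeasurable_uncurry_of_stLift_restrict`), the form demanded by the fluid classes
  (`Torus.IsWeakNSSolutionForcedOn`).
* `Torus.mFourierCoeff_conjVec_comp`, `Torus.mFourierCoeff_complexify_realPart_comp` — Fourier
  coefficients of `x ↦ conj G(x)` and of `Re G` for integrable `G : T^d → ℂ^d`
  (Grafakos 2014, Prop. 3.2.6 (4)-type identities).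
* **Riesz–Fischer with a parameter, vector and real forms** (from the accepted scalar
  `Torus.exists_memLp_two_forall_mFourierCoeff_eq`, Grafakos 2014, Prop. 3.2.7 (4)):
  `Torus.exists_memLp_two_forall_mFourierCoeff_eq_euclidean` (`ℂ^d`-valued coefficients),
  `Torus.exists_memLp_two_forall_mFourierCoeff_eq_of_tsum_lt_top` (no parameter), and the main
  result `Torus.exists_realField_forall_mFourierCoeff_eq`: for conjugate-symmetric coefficients
  `c : ℝ → ℤ^d → ℂ^d`, measurable in `t` and with `∑_k ‖c(t,k)‖²` bounded on every `[0, T]`,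
  there is `u : ℝ → T^d → ℝ^d` with space–time measurable lift on `(0, ∞) × ℝ^d` and
  `u(t) ∈ L²`, `𝓕(u(t)) = c(t)` for **every** `t ≥ 0` (strips `[m, m+1)`, gluing, and a
  modification on a null set of times using the parameter-free version).

## Mathlib search

Mathlib (this pin) has Fubini/Tonelli measurability (`AEStronglyMeasurable.prodMk_left`,
`.integral_prod_right'`), `aestronglyMeasurable_iUnion_iff`, translation invariance of Haar
measures (`measure_preimage_add`), `QuasiMeasurePreserving.prodMap`, and the Hilbert basis
`mFourierBasis` (Riesz–Fischer in `Lp`-class form); no function-level Riesz–Fischer with a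
measurable parameter beyond the accepted `TorusRieszFischerParam`, and nothing on `UnitAddTorus`
slices of space–time fields (searched `UnitAddTorus` in `MeasureTheory`: none).

## References

* J. C. Robinson, J. L. Rodrigo, W. Sadowski, *The three-dimensional Navier–Stokes equations*,
  CUP 2016, Thm. 4.4 Steps 3–4 (pp. 75–77), Thm. 4.11 (pp. 82–84), Exercises 4.2–4.9.
* L. Grafakos, *Classical Fourier Analysis*, 3rd ed., GTM 249 (2014), §3.1.1, Prop. 3.2.6,
  Prop. 3.2.7.
* E. Hopf, *Über die Anfangswertaufgabe für die hydrodynamischen Grundgleichungen*,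
  Math. Nachr. 4 (1951), 213–231, §4.
-/

noncomputable section

open MeasureTheory Set Filter Topology UnitAddTorus Function
open scoped ENNReal NNReal InnerProductSpace

namespace Literature.Analysis.FunctionSpaces

namespace Torus

variable {d : Type*} [Fintype d]

/-! ## Slices of fields with continuous space–time lift -/

section Slices

variable {F : Type*} [NormedAddCommGroup F] [NormedSpace ℝ F]
variable {S : Set ℝ} {u : ℝ → UnitAddTorus d → F}

omit [Fintype d] [NormedSpace ℝ F] in
/-- A slice `u t`, `t ∈ S`, of a field whose space–time lift is continuous on `S × ℝ^d` is
continuous on the torus (`proj` is a quotient map). [folklore] -/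
theorem continuous_slice_of_continuousOn_stLift (hu : ContinuousOn (stLift u) (S ×ˢ univ))
    {t : ℝ} (ht : t ∈ S) : Continuous (u t) := by
  have h : Continuous (u t ∘ proj) := by
    have h1 : Continuous fun y : EuclideanSpace ℝ d => stLift u (t, y) :=
      hu.comp_continuous (continuous_const.prodMk continuous_id)
        fun y => mk_mem_prod ht (mem_univ y)
    exact h1
  exact (isOpenQuotientMap_proj (d := d)).isQuotientMap.continuous_iff.2 h

omit [NormedSpace ℝ F] in
/-- **Space integrals depend continuously on time** for fields with space–time lift continuous
on `S × ℝ^d` (tube lemma over the compact torus, `Torus.eventually_norm_sub_lt_of_continuousOn`: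
`u s → u t` uniformly, and the torus has volume one). [folklore] -/
theorem continuousOn_integral_of_continuousOn_stLift [NormedSpace ℝ F] [CompleteSpace F]
    (hu : ContinuousOn (stLift u) (S ×ˢ univ)) :
    ContinuousOn (fun t => ∫ x, u t x) S := by
  intro t ht
  rw [ContinuousWithinAt, Metric.tendsto_nhds]
  intro ε hε
  filter_upwards [eventually_norm_sub_lt_of_continuousOn hu ht (half_pos hε),
    self_mem_nhdsWithin] with s hs hsS
  have hcs : Continuous (u s) := continuous_slice_of_continuousOn_stLift hu hsS
  have hct : Continuous (u t) := continuous_slice_of_continuousOn_stLift hu ht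
  rw [dist_eq_norm, ← integral_sub hcs.integrable_unitAddTorus hct.integrable_unitAddTorus]
  calc ‖∫ x, (u s x - u t x)‖ ≤ ∫ x, ‖u s x - u t x‖ := norm_integral_le_integral_norm _
    _ ≤ ∫ _ : UnitAddTorus d, ε / 2 := by
        refine integral_mono (hcs.sub hct).norm.integrable_unitAddTorus (integrable_const _)
          fun x => (hs x).le
    _ = ε / 2 := by simp
    _ < ε := half_lt_self hε

omit [Fintype d] [NormedSpace ℝ F] in
/-- Composition: a continuous function of two fields with continuous space–time lifts has a
continuous space–time lift. [folklore] -/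
theorem continuousOn_stLift_comp₂ {G H : Type*} [TopologicalSpace G] [TopologicalSpace H]
    {v : ℝ → UnitAddTorus d → G} (hu : ContinuousOn (stLift u) (S ×ˢ univ))
    (hv : ContinuousOn (stLift v) (S ×ˢ univ)) {Φ : F → G → H} (hΦ : Continuous (uncurry Φ)) :
    ContinuousOn (stLift fun t x => Φ (u t x) (v t x)) (S ×ˢ univ) :=
  hΦ.comp_continuousOn (hu.prodMk hv)

/-- Pairings of two fields with continuous space–time lifts depend continuously on time:
`t ↦ ∫ ⟪u t, v t⟫` is continuous on `S`. [folklore] -/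
theorem continuousOn_integral_inner_of_continuousOn_stLift {E : Type*} [NormedAddCommGroup E]
    [InnerProductSpace ℝ E] {u v : ℝ → UnitAddTorus d → E}
    (hu : ContinuousOn (stLift u) (S ×ˢ univ)) (hv : ContinuousOn (stLift v) (S ×ˢ univ)) :
    ContinuousOn (fun t => ∫ x, ⟪u t x, v t x⟫_ℝ) S :=
  continuousOn_integral_of_continuousOn_stLift
    (continuousOn_stLift_comp₂ hu hv (Φ := fun a b => ⟪a, b⟫_ℝ) continuous_inner)

omit [NormedSpace ℝ F] in
/-- `t ↦ ∫ ‖u t‖²` is continuous on `S` for fields with continuous space–time lift. [folklore] -/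
theorem continuousOn_integral_norm_sq_of_continuousOn_stLift
    (hu : ContinuousOn (stLift u) (S ×ˢ univ)) :
    ContinuousOn (fun t => ∫ x, ‖u t x‖ ^ 2) S :=
  continuousOn_integral_of_continuousOn_stLift
    (continuousOn_stLift_comp₂ hu hu (Φ := fun a _ => ‖a‖ ^ 2) ((continuous_norm.pow 2).comp
      continuous_fst))

/-- **The spatial Fourier coefficients depend continuously on time**: for a real vector field
with space–time lift continuous on `S × ℝ^d`, `t ↦ 𝓕(complexify ∘ u t)(k)` is continuous on
`S` for every `k`. [folklore] -/
theorem continuousOn_mFourierCoeff_of_continuousOn_stLift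
    {u : ℝ → UnitAddTorus d → EuclideanSpace ℝ d} (hu : ContinuousOn (stLift u) (S ×ˢ univ))
    (k : d → ℤ) :
    ContinuousOn (fun t => mFourierCoeff (EuclideanSpace.complexify ∘ u t) k) S := by
  have h : ContinuousOn (stLift fun t x => mFourier (-k) x • EuclideanSpace.complexify (u t x))
      (S ×ˢ univ) := by
    have h1 : ContinuousOn (fun p : ℝ × EuclideanSpace ℝ d => mFourier (-k) (proj p.2))
        (S ×ˢ univ) :=
      ((mFourier (-k)).continuous.comp (continuous_proj.comp continuous_snd)).continuousOn
    exact h1.smul (EuclideanSpace.continuous_complexify.comp_continuousOn hu)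
  refine (continuousOn_integral_of_continuousOn_stLift h).congr fun t _ => ?_
  rw [mFourierCoeff_eq_integral_volume]
  rfl

end Slices

/-! ## Slices of `L²ₜL²ₓ` fields -/

section L2Slices

variable {f : ℝ → UnitAddTorus d → EuclideanSpace ℝ d} {T : ℝ}

/-- From measurability of the space–time lift on `(0, ∞) × ℝ^d` to measurability of the
uncurried field on `(0, T) × T^d` for the product of the restricted Lebesgue measures. [folklore] -/
theorem aestronglyMeasurable_uncurry_prod_of_stLift
    (hf : AEStronglyMeasurable (stLift f) (volume.restrict (Ioi 0 ×ˢ univ))) (T : ℝ) :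
    AEStronglyMeasurable (uncurry f) ((volume.restrict (Ioo 0 T)).prod volume) := by
  have h1 := aestronglyMeasurable_uncurry_of_stLift_restrict hf
  have h2 : AEStronglyMeasurable (uncurry f) (volume.restrict (Ioo 0 T ×ˢ univ)) :=
    h1.mono_measure (Measure.restrict_mono (prod_mono Ioo_subset_Ioi_self subset_rfl) le_rfl)
  rwa [Measure.volume_eq_prod, ← Measure.prod_restrict, Measure.restrict_univ] at h2

/-- **Almost every time slice of an `L²ₜL²ₓ` field is in `L²(T^d)`.** [folklore] -/
theorem ae_memLp_slice (hf : AEStronglyMeasurable (stLift f) (volume.restrict (Ioi 0 ×ˢ univ)))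
    (hf₂ : ∫⁻ t in Ioo 0 T, ∫⁻ x, ‖f t x‖ₑ ^ 2 < ⊤) :
    ∀ᵐ t ∂(volume.restrict (Ioo 0 T)), MemLp (f t) 2 volume := by
  have hF := aestronglyMeasurable_uncurry_prod_of_stLift hf T
  have hmeas : ∀ᵐ t ∂(volume.restrict (Ioo 0 T)), AEStronglyMeasurable (f t) volume :=
    hF.prodMk_left
  have hint : AEMeasurable (fun t => ∫⁻ x, ‖f t x‖ₑ ^ 2) (volume.restrict (Ioo 0 T)) :=
    (hF.aemeasurable.enorm.pow_const 2).lintegral_prod_right'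
  have hfin : ∀ᵐ t ∂(volume.restrict (Ioo 0 T)), ∫⁻ x, ‖f t x‖ₑ ^ 2 < ⊤ :=
    ae_lt_top' hint hf₂.ne
  filter_upwards [hmeas, hfin] with t ht ht'
  refine ⟨ht, (eLpNorm_lt_top_iff_lintegral_rpow_enorm_lt_top two_ne_zero
    ENNReal.ofNat_ne_top).2 ?_⟩
  simpa only [ENNReal.toReal_ofNat, ENNReal.rpow_two] using ht'

/-- **Time-measurability of the spatial Fourier coefficients** of a space–time measurable
field: `t ↦ 𝓕(f t)(k)` is a.e.-strongly measurable on `(0, T)` (Fubini). [folklore] -/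
theorem aestronglyMeasurable_mFourierCoeff_stSlice
    (hf : AEStronglyMeasurable (stLift f) (volume.restrict (Ioi 0 ×ˢ univ))) (T : ℝ) (k : d → ℤ) :
    AEStronglyMeasurable (fun t => mFourierCoeff (EuclideanSpace.complexify ∘ f t) k)
      (volume.restrict (Ioo 0 T)) := by
  have hF := aestronglyMeasurable_uncurry_prod_of_stLift hf T
  have hG : AEStronglyMeasurable (fun p : ℝ × UnitAddTorus d =>
      mFourier (-k) p.2 • EuclideanSpace.complexify (uncurry f p))
      ((volume.restrict (Ioo 0 T)).prod volume) :=
    ((mFourier (-k)).continuous.comp continuous_snd).aestronglyMeasurable.smul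
      (EuclideanSpace.continuous_complexify.comp_aestronglyMeasurable hF)
  have h := hG.integral_prod_right'
  refine h.congr (ae_of_all _ fun t => ?_)
  simp only [mFourierCoeff_eq_integral_volume, comp_apply, uncurry_apply_pair]

end L2Slices

/-! ## The covering map pulls null sets back to null sets -/

section Covering

/-- **`proj : ℝ^d → T^d` is quasi measure preserving** for Lebesgue measure and the volume of
the torus: `proj⁻¹ N` is covered by the lattice translates `m + (proj⁻¹ N ∩ [0,1)^d)`,
`m ∈ ℤ^d`, each of measure `vol (proj⁻¹ N ∩ [0,1)^d) = vol N`
(`Torus.measurePreserving_proj_unitCube`, translation invariance of Lebesgue measure)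
(Grafakos 2014, §3.1.1: functions on `Tⁿ` are the `1`-periodic functions on `ℝⁿ`). [cite: Grafakos2014, §3.1.1] -/
theorem quasiMeasurePreserving_proj :
    Measure.QuasiMeasurePreserving (proj : EuclideanSpace ℝ d → UnitAddTorus d) volume volume := by
  classical
  refine ⟨measurable_proj, Measure.AbsolutelyContinuous.mk fun N hN hN0 => ?_⟩
  rw [Measure.map_apply measurable_proj hN]
  -- the piece in the fundamental domain is null
  have hmp := measurePreserving_proj_unitCube_holds (d := d)
  have h0 : volume (proj ⁻¹' N ∩ unitCube d) = 0 := by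
    have h := hmp.measure_preimage hN.nullMeasurableSet
    rw [Measure.restrict_apply (measurable_proj hN)] at h
    rw [h, hN0]
  -- cover by lattice translates
  have hcover : proj ⁻¹' N ⊆ ⋃ m : d → ℤ, (fun y => -latticeVec m + y) ⁻¹' (proj ⁻¹' N ∩ unitCube d) := by
    intro y hy
    refine mem_iUnion.2 ⟨fun i => ⌊y i⌋, ?_⟩
    refine ⟨?_, ?_⟩
    · show proj (-latticeVec (fun i => ⌊y i⌋) + y) ∈ N
      rw [proj_add, proj_neg, proj_latticeVec, neg_zero, zero_add]
      exact hy
    · rw [mem_unitCube]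
      intro i
      simp only [PiLp.add_apply, PiLp.neg_apply, latticeVec_apply]
      constructor
      · linarith [Int.floor_le (y i)]
      · linarith [Int.lt_floor_add_one (y i)]
  refine measure_mono_null hcover (measure_iUnion_null fun m => ?_)
  rw [measure_preimage_add]
  exact h0

/-- **Measurability transfer to the space–time lift.** If `uncurry u : ℝ × T^d → F` is a.e.
strongly measurable for `(vol|_S) ⊗ vol`, then the space–time lift `stLift u = uncurry u ∘ (id × proj)`
is a.e. strongly measurable on `S × ℝ^d` (`id × proj` is quasi measure preserving). Converse of
`Torus.aestronglyMeasurable_uncurry_of_stLift_restrict`. [folklore] -/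
theorem aestronglyMeasurable_stLift_of_uncurry {F : Type*} [TopologicalSpace F] {S : Set ℝ}
    {u : ℝ → UnitAddTorus d → F}
    (hu : AEStronglyMeasurable (uncurry u) ((volume.restrict S).prod volume)) :
    AEStronglyMeasurable (stLift u) (volume.restrict (S ×ˢ (univ : Set (EuclideanSpace ℝ d)))) := by
  have h : stLift u = uncurry u ∘ Prod.map id proj := by
    funext ⟨t, y⟩
    rfl
  rw [h, Measure.volume_eq_prod, ← Measure.restrict_prod_eq_prod_univ]
  exact hu.comp_quasiMeasurePreserving
    (MeasureTheory.QuasiMeasurePreserving.prodMap (Measure.QuasiMeasurePreserving.id _)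
      quasiMeasurePreserving_proj)

end Covering

/-! ## Fourier coefficients of conjugates and real parts of `ℂ^d`-valued functions -/

section ConjRealPart

/-- `𝓕(conj ∘ G)(k) = conj (𝓕 G (-k))` for integrable `G : T^d → ℂ^d`
(Grafakos 2014, Prop. 3.2.6 (4)-type identity; conjugation is a real-linear isometry and
commutes with the Bochner integral). [cite: Grafakos2014, Prop. 3.2.6] -/
theorem mFourierCoeff_conjVec_comp {G : UnitAddTorus d → EuclideanSpace ℂ d}
    (hG : Integrable G volume) (k : d → ℤ) :
    mFourierCoeff (fun x => EuclideanSpace.conjVec (G x)) k =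
      EuclideanSpace.conjVec (mFourierCoeff G (-k)) := by
  rw [mFourierCoeff_eq_integral_volume, mFourierCoeff_eq_integral_volume, neg_neg]
  have h1 : (fun x => mFourier (-k) x • EuclideanSpace.conjVec (G x)) =
      fun x => EuclideanSpace.conjVecL (mFourier k x • G x) := by
    funext x
    rw [EuclideanSpace.conjVecL_apply, EuclideanSpace.conjVec_smul, ← mFourier_neg]
  rw [h1, ContinuousLinearMap.integral_comp_comm _ ?_, EuclideanSpace.conjVecL_apply]
  simpa using integrable_mFourier_smul' hG (-k)

/-- **Fourier coefficients of the real part**: for integrable `G : T^d → ℂ^d`,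
`𝓕(complexify ∘ Re G)(k) = ½ (𝓕 G (k) + conj (𝓕 G (-k)))`. [folklore] -/
theorem mFourierCoeff_complexify_realPart_comp {G : UnitAddTorus d → EuclideanSpace ℂ d}
    (hG : Integrable G volume) (k : d → ℤ) :
    mFourierCoeff (EuclideanSpace.complexify ∘ fun x => EuclideanSpace.realPart (G x)) k =
      (2 : ℂ)⁻¹ • (mFourierCoeff G k + EuclideanSpace.conjVec (mFourierCoeff G (-k))) := by
  have hfun : (EuclideanSpace.complexify ∘ fun x => EuclideanSpace.realPart (G x)) =
      (2 : ℂ)⁻¹ • fun x => G x + EuclideanSpace.conjVec (G x) := by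
    funext x
    simp only [comp_apply, Pi.smul_apply]
    exact EuclideanSpace.complexify_realPart_eq (G x)
  have hconj : Integrable (fun x => EuclideanSpace.conjVec (G x)) volume :=
    EuclideanSpace.conjVecL.integrable_comp hG
  rw [hfun, mFourierCoeff_const_smul, ← mFourierCoeff_conjVec_comp hG]
  congr 1
  simp only [mFourierCoeff_eq_integral_volume, smul_add]
  exact integral_add (integrable_mFourier_smul' hG k) (integrable_mFourier_smul' hconj k)

/-- For conjugate-symmetric target coefficients the real part loses nothing: if `𝓕 G = c` with
`c (-k) = conj (c k)`, then `𝓕(complexify ∘ Re G) = c`. [folklore] -/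
theorem mFourierCoeff_complexify_realPart_comp_of_isConjSymm
    {G : UnitAddTorus d → EuclideanSpace ℂ d} (hG : Integrable G volume)
    {c : (d → ℤ) → EuclideanSpace ℂ d} (hc : IsConjSymm c) (hGc : ∀ k, mFourierCoeff G k = c k)
    (k : d → ℤ) :
    mFourierCoeff (EuclideanSpace.complexify ∘ fun x => EuclideanSpace.realPart (G x)) k = c k := by
  rw [mFourierCoeff_complexify_realPart_comp hG, hGc, hGc, hc k, EuclideanSpace.conjVec_conjVec,
    ← two_smul ℂ (c k), smul_smul, inv_mul_cancel₀ two_ne_zero, one_smul]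

end ConjRealPart

/-! ## Riesz–Fischer with a parameter: vector-valued and real forms -/

section RieszFischer

variable {α : Type*} [MeasurableSpace α] {μ : Measure α}

/-- **Riesz–Fischer on `T^d` with a measurable parameter, `ℂ^d`-valued coefficients**
(componentwise from the accepted scalar `Torus.exists_memLp_two_forall_mFourierCoeff_eq`;
Grafakos 2014, Prop. 3.2.7 (4)): square-integrable measurable coefficient families
`c : α → ℤ^d → ℂ^d` are the Fourier coefficients of a jointly measurable `G : α × T^d → ℂ^d`
with `G t ∈ L²` for a.e. `t`. [cite: Grafakos2014, Prop. 3.2.7] -/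
theorem exists_memLp_two_forall_mFourierCoeff_eq_euclidean [IsFiniteMeasure μ]
    {c : α → (d → ℤ) → EuclideanSpace ℂ d} (hc : ∀ k, AEStronglyMeasurable (fun t => c t k) μ)
    (hC : ∫⁻ t, ∑' k, ‖c t k‖ₑ ^ 2 ∂μ ≠ ⊤) :
    ∃ G : α → UnitAddTorus d → EuclideanSpace ℂ d,
      AEStronglyMeasurable (uncurry G) (μ.prod volume) ∧
      ∀ᵐ t ∂μ, MemLp (G t) 2 volume ∧ ∀ k, mFourierCoeff (G t) k = c t k := by
  classical
  -- componentwise data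
  have hcj : ∀ j : d, ∀ k, AEStronglyMeasurable (fun t => c t k j) μ := fun j k =>
    (EuclideanSpace.proj j : EuclideanSpace ℂ d →L[ℂ] ℂ).continuous.comp_aestronglyMeasurable (hc k)
  have hCj : ∀ j : d, ∫⁻ t, ∑' k, ‖c t k j‖ₑ ^ 2 ∂μ ≠ ⊤ := by
    intro j
    refine ne_top_of_le_ne_top hC (lintegral_mono fun t => ENNReal.tsum_le_tsum fun k => ?_)
    gcongr
    rw [← ofReal_norm, ← ofReal_norm]
    exact ENNReal.ofReal_le_ofReal (by simpa using PiLp.norm_apply_le (c t k) j)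
  choose g hgm hg using fun j : d => exists_memLp_two_forall_mFourierCoeff_eq (hcj j) (hCj j)
  -- assemble the vector field
  refine ⟨fun t x => ∑ j, g j t x • EuclideanSpace.single j (1 : ℂ), ?_, ?_⟩
  · have h : uncurry (fun t x => ∑ j, g j t x • EuclideanSpace.single j (1 : ℂ)) =
        fun p => ∑ j, uncurry (g j) p • EuclideanSpace.single j (1 : ℂ) := by
      funext ⟨t, x⟩
      simp
    rw [h]
    exact Finset.aestronglyMeasurable_fun_sum _ fun j _ => (hgm j).smul_const _
  · have hall : ∀ᵐ t ∂μ, ∀ j, MemLp (g j t) 2 volume ∧ ∀ k, mFourierCoeff (g j t) k = c t k j :=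
      ae_all_iff.2 hg
    filter_upwards [hall] with t ht
    have hmem : MemLp (fun x => ∑ j, g j t x • EuclideanSpace.single j (1 : ℂ)) 2 volume :=
      memLp_finsetSum _ fun j _ =>
        (ContinuousLinearMap.toSpanSingleton ℂ (EuclideanSpace.single j (1 : ℂ))).comp_memLp'
          (ht j).1
    refine ⟨hmem, fun k => ?_⟩
    have hint : Integrable (fun x => ∑ j, g j t x • EuclideanSpace.single j (1 : ℂ)) volume :=
      hmem.integrable one_le_two
    ext i
    rw [mFourierCoeff_apply_euclidean hint]
    have hcoord : (fun x => (∑ j, g j t x • EuclideanSpace.single j (1 : ℂ)) i) = g i t := by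
      funext x
      simp [Finset.sum_apply, Pi.single_apply]
    rw [hcoord, (ht i).2 k]

/-- **Riesz–Fischer on `T^d`, `ℂ^d`-valued, no parameter**: every square-summable family
`c : ℤ^d → ℂ^d` is the Fourier coefficient family of some `G ∈ L²(T^d; ℂ^d)` (the parametrised
theorem over the one-point probability space; Grafakos 2014, Prop. 3.2.7 (4)). [cite: Grafakos2014, Prop. 3.2.7] -/
theorem exists_memLp_two_forall_mFourierCoeff_eq_of_tsum_lt_top
    {c : (d → ℤ) → EuclideanSpace ℂ d} (hc : ∑' k, ‖c k‖ₑ ^ 2 < ⊤) :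
    ∃ G : UnitAddTorus d → EuclideanSpace ℂ d, MemLp G 2 volume ∧ ∀ k, mFourierCoeff G k = c k := by
  have h1 : ∀ k, AEStronglyMeasurable (fun _ : Unit => c k) (Measure.dirac ()) := fun k =>
    aestronglyMeasurable_const
  have h2 : ∫⁻ _ : Unit, ∑' k, ‖c k‖ₑ ^ 2 ∂(Measure.dirac ()) ≠ ⊤ := by
    rw [lintegral_dirac]
    exact hc.ne
  obtain ⟨G, -, hG⟩ := exists_memLp_two_forall_mFourierCoeff_eq_euclidean
    (μ := Measure.dirac ()) (c := fun _ : Unit => c) h1 h2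
  rw [ae_dirac_eq, eventually_pure] at hG
  exact ⟨G (), hG.1, hG.2⟩

/-- **`L²` fields with prescribed Fourier coefficients for every time.** Let
`c : ℝ → ℤ^d → ℂ^d` be conjugate symmetric (`c t (-k) = conj (c t k)`, `t ≥ 0`), measurable in
`t` on `(0, ∞)` for each `k`, and square summable with `∑_k ‖c t k‖²` bounded on every `[0, T]`.
Then there is a real field `u : ℝ → T^d → ℝ^d` whose space–time lift is a.e. strongly
measurable on `(0, ∞) × ℝ^d` and such that, for **every** `t ≥ 0`, `u t ∈ L²(T^d)` and
`𝓕(complexify ∘ u t) = c t`. Construction: the parametrised Riesz–Fischer theorem on each time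
strip `[m, m+1)`, glued, gives a jointly measurable candidate correct for a.e. `t`; on the
exceptional null set of times it is replaced slice by slice by the parameter-free Riesz–Fischer
representative, which does not affect joint measurability; finally the real part is taken
(`mFourierCoeff_complexify_realPart_comp_of_isConjSymm`). This is the step "define `u(t)` by its
Fourier coefficients" of Hopf's compactness method (Hopf 1951, §4; Robinson–Rodrigo–Sadowski
2016, proof of Thm. 4.11 and Exercises 4.5–4.9). [cite: RobinsonRodrigoSadowski2016, Thm. 4.11] -/
theorem exists_realField_forall_mFourierCoeff_eq {c : ℝ → (d → ℤ) → EuclideanSpace ℂ d}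
    (hmeas : ∀ k, AEStronglyMeasurable (fun t => c t k) (volume.restrict (Ioi 0)))
    (hbound : ∀ T : ℝ, ∃ K : ℝ≥0∞, K ≠ ⊤ ∧ ∀ t ∈ Icc 0 T, ∑' k, ‖c t k‖ₑ ^ 2 ≤ K)
    (hsymm : ∀ t, 0 ≤ t → IsConjSymm (c t)) :
    ∃ u : ℝ → UnitAddTorus d → EuclideanSpace ℝ d,
      AEStronglyMeasurable (stLift u) (volume.restrict (Ioi 0 ×ˢ univ)) ∧
      ∀ t, 0 ≤ t → MemLp (u t) 2 volume ∧
        ∀ k, mFourierCoeff (EuclideanSpace.complexify ∘ u t) k = c t k := by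
  classical
  -- Step 1: a jointly measurable candidate on each strip `[m, m+1)`
  set strip : ℕ → Set ℝ := fun m => Ico (m : ℝ) (m + 1) with hstrip
  have hstrip_meas : ∀ m, MeasurableSet (strip m) := fun m => measurableSet_Ico
  haveI : ∀ m, IsFiniteMeasure (volume.restrict (strip m)) := fun m =>
    isFiniteMeasure_restrict.2 measure_Ico_lt_top.ne
  have hstrip_le : ∀ m : ℕ, volume.restrict (strip m) ≤ volume.restrict (Ioi (0 : ℝ)) := by
    intro m
    refine Measure.restrict_mono_ae (ae_le_set.2 ?_)
    refine measure_mono_null (fun t ht => ?_) (measure_singleton (0 : ℝ))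
    obtain ⟨⟨hmt, -⟩, ht0⟩ := ht
    have h0t : (0 : ℝ) ≤ t := le_trans (Nat.cast_nonneg m) hmt
    exact le_antisymm (not_lt.1 ht0) h0t
  have hGm : ∀ m : ℕ, ∃ G : ℝ → UnitAddTorus d → EuclideanSpace ℂ d,
      AEStronglyMeasurable (uncurry G) ((volume.restrict (strip m)).prod volume) ∧
      ∀ᵐ t ∂(volume.restrict (strip m)), MemLp (G t) 2 volume ∧
        ∀ k, mFourierCoeff (G t) k = c t k := by
    intro m
    refine exists_memLp_two_forall_mFourierCoeff_eq_euclidean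
      (fun k => (hmeas k).mono_measure (hstrip_le m)) ?_
    obtain ⟨K, hK, hKb⟩ := hbound (m + 1)
    refine ne_top_of_le_ne_top (ENNReal.mul_ne_top hK
      (measure_ne_top (volume.restrict (strip m)) univ)) ?_
    calc ∫⁻ t, ∑' k, ‖c t k‖ₑ ^ 2 ∂(volume.restrict (strip m))
        ≤ ∫⁻ _, K ∂(volume.restrict (strip m)) := by
          refine setLIntegral_mono' (hstrip_meas m) fun t ht => hKb t ⟨?_, ht.2.le⟩
          exact le_trans (Nat.cast_nonneg m) ht.1
      _ = K * volume.restrict (strip m) univ := by rw [lintegral_const]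
  choose G hGmeas hGae using hGm
  -- Step 2: glue along `m = ⌊t⌋₊`
  set G₁ : ℝ → UnitAddTorus d → EuclideanSpace ℂ d := fun t => G ⌊t⌋₊ t with hG₁
  have hfloor : ∀ m : ℕ, ∀ t ∈ strip m, ⌊t⌋₊ = m := fun m t ht => Nat.floor_eq_on_Ico m t ht
  have hG₁meas : ∀ m : ℕ, AEStronglyMeasurable (uncurry G₁)
      ((volume.prod volume).restrict (strip m ×ˢ (univ : Set (UnitAddTorus d)))) := by
    intro m
    have h := hGmeas m
    rw [Measure.restrict_prod_eq_prod_univ] at h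
    refine h.congr ?_
    refine (ae_restrict_mem ((hstrip_meas m).prod MeasurableSet.univ)).mono ?_
    rintro ⟨t, x⟩ ⟨ht, -⟩
    show uncurry (G m) (t, x) = uncurry G₁ (t, x)
    simp only [uncurry_apply_pair, hG₁, hfloor m t ht]
  -- good times: the glued candidate has the right slice
  set good : ℝ → Prop := fun t => MemLp (G₁ t) 2 volume ∧ ∀ k, mFourierCoeff (G₁ t) k = c t k
    with hgood
  have hgood_ae : ∀ m : ℕ, ∀ᵐ t ∂(volume.restrict (strip m)), good t := by
    intro m
    filter_upwards [hGae m, ae_restrict_mem (hstrip_meas m)] with t ht hts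
    show MemLp (G ⌊t⌋₊ t) 2 volume ∧ ∀ k, mFourierCoeff (G ⌊t⌋₊ t) k = c t k
    rw [hfloor m t hts]
    exact ht
  -- the bad nonnegative times form a null set; enclose it in a measurable null set
  have hbad_null : volume {t | t ∈ Ici (0 : ℝ) ∧ ¬good t} = 0 := by
    have hcov : {t | t ∈ Ici (0 : ℝ) ∧ ¬good t} ⊆ ⋃ m : ℕ, {t | t ∈ strip m ∧ ¬good t} := by
      rintro t ⟨ht0, hbad⟩
      exact mem_iUnion.2 ⟨⌊t⌋₊, ⟨Nat.floor_le ht0, Nat.lt_floor_add_one t⟩, hbad⟩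
    refine measure_mono_null hcov (measure_iUnion_null fun m => ?_)
    have h := hgood_ae m
    rw [ae_restrict_iff' (hstrip_meas m), ae_iff] at h
    refine measure_mono_null ?_ h
    intro t ht himp
    exact ht.2 (himp ht.1)
  obtain ⟨Nbad, hNsub, -, hN0⟩ := exists_measurable_superset_of_null hbad_null
  -- Step 3: slice-by-slice repair on the bad set (parameter-free Riesz–Fischer)
  have hrep : ∀ t, ∃ R : UnitAddTorus d → EuclideanSpace ℂ d,
      0 ≤ t → MemLp R 2 volume ∧ ∀ k, mFourierCoeff R k = c t k := by
    intro t
    by_cases ht : 0 ≤ t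
    · obtain ⟨K, hK, hKb⟩ := hbound t
      obtain ⟨R, hR⟩ := exists_memLp_two_forall_mFourierCoeff_eq_of_tsum_lt_top
        (lt_of_le_of_lt (hKb t ⟨ht, le_rfl⟩) hK.lt_top)
      exact ⟨R, fun _ => hR⟩
    · exact ⟨0, fun h => absurd h ht⟩
  choose R hR using hrep
  set G₂ : ℝ → UnitAddTorus d → EuclideanSpace ℂ d := fun t => if good t then G₁ t else R t
    with hG₂
  have hG₂good : ∀ t, 0 ≤ t → MemLp (G₂ t) 2 volume ∧ ∀ k, mFourierCoeff (G₂ t) k = c t k := by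
    intro t ht
    by_cases hg : good t
    · simp only [hG₂, if_pos hg]
      exact hg
    · simp only [hG₂, if_neg hg]
      exact hR t ht
  have hG₂meas : AEStronglyMeasurable (uncurry G₂)
      ((volume.restrict (Ioi 0)).prod (volume : Measure (UnitAddTorus d))) := by
    -- `G₂ = G₁` off `Nbad × T^d`, a null set of `(0, ∞) × T^d`
    have h1 : AEStronglyMeasurable (uncurry G₁)
        ((volume.prod volume).restrict (Ioi 0 ×ˢ (univ : Set (UnitAddTorus d)))) := by
      have hsub : Ioi (0 : ℝ) ×ˢ (univ : Set (UnitAddTorus d)) ⊆ ⋃ m : ℕ, strip m ×ˢ univ := by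
        rintro ⟨t, x⟩ ⟨ht, -⟩
        exact mem_iUnion.2 ⟨⌊t⌋₊, ⟨Nat.floor_le (le_of_lt ht), Nat.lt_floor_add_one t⟩,
          mem_univ _⟩
      exact (aestronglyMeasurable_iUnion_iff.2 hG₁meas).mono_measure
        (Measure.restrict_mono hsub le_rfl)
    rw [Measure.restrict_prod_eq_prod_univ]
    refine h1.congr ?_
    have hnull : (volume.prod (volume : Measure (UnitAddTorus d)))
        (Nbad ×ˢ (univ : Set (UnitAddTorus d))) = 0 := by
      rw [Measure.prod_prod, hN0, zero_mul]
    have hae : ∀ᵐ p ∂(volume.prod (volume : Measure (UnitAddTorus d))),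
        p ∉ Nbad ×ˢ (univ : Set (UnitAddTorus d)) :=
      (measure_eq_zero_iff_ae_notMem.1 hnull)
    rw [Filter.EventuallyEq, ae_restrict_iff' (measurableSet_Ioi.prod MeasurableSet.univ)]
    filter_upwards [hae] with p hp hpI
    obtain ⟨t, x⟩ := p
    have ht : (0 : ℝ) < t := hpI.1
    have htN : t ∉ Nbad := fun h => hp ⟨h, mem_univ _⟩
    show G₁ t x = G₂ t x
    by_cases hg : good t
    · simp only [hG₂, if_pos hg]
    · exact absurd (hNsub ⟨ht.le, hg⟩) htN
  -- Step 4: the real part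
  refine ⟨fun t x => EuclideanSpace.realPart (G₂ t x), ?_, fun t ht => ⟨?_, fun k => ?_⟩⟩
  · refine aestronglyMeasurable_stLift_of_uncurry ?_
    exact EuclideanSpace.realPart.continuous.comp_aestronglyMeasurable hG₂meas
  · exact EuclideanSpace.realPart.comp_memLp' (hG₂good t ht).1
  · exact mFourierCoeff_complexify_realPart_comp_of_isConjSymm
      ((hG₂good t ht).1.integrable one_le_two) (hsymm t ht) (hG₂good t ht).2 k

end RieszFischer

end Torus

end Literature.Analysis.FunctionSpaces
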